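import Mathlib
import Summits.CriticalPhenomena.PercolationContinuityZ3.Theorems.PercNearOneGluingNoHeavyLowerTailHurwitzOddPairTN
import HarnessLib

/-!
# THEOREM R^neut: the operator Hurwitz matrix of neutral copies is totally nonnegative (kernel form)

Support file for the Sahi / Conjecture-P programme of route `PercNearOneGluingNoHeavy`
(`--supports stmt-CriticalPhenomena-4575`, prover prim-l12-p5 gen 49; proof notes
`prim-l12-p5/PROOF-NEUTRAL-HURWITZ-g47.md` §2 (the theorem and its pencil proof) and
`prim-l12-p5/PROOF-NEUTRAL-HURWITZ-LEAN-g49.md` (this formalisation)).  No definitions, no named facts, no sorries.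

For `T = k+1` NEUTRAL copies `φ_σ(X) = X + b_σ` (idle weights `0 < b_0 < … < b_k`, slope `g = 1`) at level `q > 0`
the λ-free band matrix of g45/g46 is `W(m, m-d) = e_d(b)·m^{(d)}·(q+m)_{T-d}/(q)_T` (Chu–Vandermonde, g47 (2.1)), and
its operator Hurwitz matrix `R(W) = interleave(W(m,·), W(m+1,·) - W(m,·-1))` is, after positive diagonal scalings
of rows and columns, the kernel
`K(2m, l) = (q + k + l)·e_{m-l}`,  `K(2m+1, l) = ((m+1)(q+k) + (1-q)·l)·e_{m+1-l}`   (`e_d = [X^d]∏_σ(1 + b_σX)`).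
**`DiffHurwitz.neutral_hurwitz_kernel_tn`**: `K` is totally nonnegative for every `k` and every `q > 0`.
Proof (g47 §2, reorganised): with `E = ∏(1 + b_σX)`, `E' = dE/dX` and `E♭ = (k+1)E - X·E'`, the pair `(E♭, E')` is
an odd positive pair (`DiffHurwitz.neutralPair_roots`: Rolle for `E'`, a sign count for `E♭`, one zero of each in
every gap between the zeros `-1/b_σ` of `E`, the zero of `E'` to the left), so its Hurwitz kernel `M` is TN
(`DiffHurwitz.oddPair_hurwitz_tn`); and `K` is `M` after an up-step with `f(2m+1) = (m+1)/(q+m)`, the row scaling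
`d(2m+2) = (q+k)/(q+m+1+k)`, a down-step with `e(2m+2) = (q+m)/(q+m+1+k)` and positive row factors — the pencil
identities `A_m = ((q+m-1)/T)·E♭_m + ((q+m-1+T)/T)·E'_m`, `B_m = (q+m)·E♭_{m+1} + (m+1)·E'_{m+1}` of the memo.
The identification with `R(W)` itself is `DiffHurwitz.neutral_hurwitz_tn` (file `…NeutralHurwitzRTN`).
-/

namespace Summit.CriticalPhenomena.PercolationContinuityZ3.Theorems

namespace DiffHurwitz

open Finset Polynomial FallingMesh

/-- **The neutral pair.**  For `0 < b_0 < b_1 < … < b_k` let `E = ∏_{σ≤k}(1 + b_σ X)`.  Then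
`E♭ := (k+1)·E - X·E'` and `E'` have product forms `lp·∏_{i<k}(X - α_i)`, `lq·∏_{i<k}(X - γ_i)` with
`lp, lq > 0` and `γ_0 < α_0 < γ_1 < … < γ_{k-1} < α_{k-1} < 0` (one zero of each in every gap between
consecutive zeros `-1/b_σ` of `E`, the zero of `E'` to the left: Rolle + the intermediate value theorem). -/
theorem neutralPair_roots (k : ℕ) (b : ℕ → ℝ) (hb0 : 0 < b 0) (hb : StrictMono b) :
    ∃ (lp lq : ℝ) (α γ : ℕ → ℝ), 0 < lp ∧ 0 < lq ∧ (∀ i, i < k → α i < 0) ∧ (∀ i, i < k → γ i < α i) ∧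
      (∀ i, i + 1 < k → α i < γ (i + 1)) ∧
      C ((k : ℝ) + 1) * (∏ σ ∈ range (k + 1), (1 + C (b σ) * X)) -
          derivative (∏ σ ∈ range (k + 1), (1 + C (b σ) * X)) * X = C lp * ∏ i ∈ range k, (X - C (α i)) ∧
      derivative (∏ σ ∈ range (k + 1), (1 + C (b σ) * X)) = C lq * ∏ i ∈ range k, (X - C (γ i)) := by
  have hbpos : ∀ i, 0 < b i := fun i => lt_of_lt_of_le hb0 (hb.monotone (Nat.zero_le i))
  -- the zeros of E
  set ρ : ℕ → ℝ := fun i => -(b i)⁻¹ with hρ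
  have hρneg : ∀ i, ρ i < 0 := fun i => by simp only [hρ]; exact neg_neg_of_pos (inv_pos.2 (hbpos i))
  have hρmono : ∀ i j, i < j → ρ i < ρ j := by
    intro i j hij
    simp only [hρ]
    have := hb hij
    have hi := hbpos i
    rw [neg_lt_neg_iff, inv_lt_inv₀ (hbpos j) (hbpos i)]
    exact this
  have hρle : ∀ i j, i ≤ j → ρ i ≤ ρ j := by
    intro i j hij
    rcases Nat.lt_or_ge i j with h | h
    · exact (hρmono i j h).le
    · rw [show i = j by omega]
  set lE : ℝ := ∏ σ ∈ range (k + 1), b σ with hlE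
  have hlEpos : 0 < lE := prod_pos fun σ _ => hbpos σ
  obtain ⟨E, hE⟩ : ∃ E : ℝ[X], E = ∏ σ ∈ range (k + 1), (1 + C (b σ) * X) := ⟨_, rfl⟩
  have hEform : E = C lE * ∏ i ∈ range (k + 1), (X - C (ρ i)) := by
    rw [hE, hlE, map_prod C, ← prod_mul_distrib]
    refine prod_congr rfl fun σ _ => ?_
    simp only [hρ]
    rw [C_neg, sub_neg_eq_add, mul_add, ← C_mul, mul_inv_cancel₀ (ne_of_gt (hbpos σ)), C_1, add_comm]
  obtain ⟨hEnd, hElc⟩ := prodForm_natDegree lE (ne_of_gt hlEpos) ρ (k + 1)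
  rw [← hEform] at hEnd hElc
  have hEev : ∀ y, E.eval y = lE * ∏ i ∈ range (k + 1), (y - ρ i) := fun y => by rw [hEform, prodForm_eval]
  have hEroot : ∀ j, j < k + 1 → E.eval (ρ j) = 0 := fun j hj => by
    rw [hEev]; exact mul_eq_zero_of_right _ (prod_eq_zero (mem_range.2 hj) (sub_self _))
  ------------------------------------------------------------------ E' (Rolle)
  set E' : ℝ[X] := derivative E with hE'
  have hexγ : ∀ j, j < k → ∃ x, ρ j < x ∧ x < ρ (j + 1) ∧ E'.eval x = 0 := by
    intro j hj
    obtain ⟨x, hx, hx0⟩ := exists_deriv_eq_zero (f := fun y => E.eval y) (hρmono j (j + 1) (by omega))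
      E.continuous.continuousOn (by rw [hEroot j (by omega), hEroot (j + 1) (by omega)])
    refine ⟨x, hx.1, hx.2, ?_⟩
    rw [hE', ← Polynomial.deriv]; exact hx0
  choose! γ hγ using hexγ
  have hγ1 : ∀ j, j < k → ρ j < γ j := fun j hj => (hγ j hj).1
  have hγ2 : ∀ j, j < k → γ j < ρ (j + 1) := fun j hj => (hγ j hj).2.1
  have hγ3 : ∀ j, j < k → E'.eval (γ j) = 0 := fun j hj => (hγ j hj).2.2
  have hγmono : ∀ i j, i < j → j < k → γ i < γ j := by
    intro i j hij hjk; linarith [hγ2 i (by omega), hγ1 j hjk, hρle (i + 1) j (by omega)]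
  have hγle : ∀ i j, i ≤ j → j < k → γ i ≤ γ j := by
    intro i j hij hjk
    rcases Nat.lt_or_ge i j with h | h
    · exact (hγmono i j h hjk).le
    · rw [show i = j by omega]
  have hγneg : ∀ j, j < k → γ j < 0 := fun j hj => lt_trans (hγ2 j hj) (hρneg _)
  have hE'le : E'.natDegree ≤ k := by
    have h := natDegree_derivative_le E
    rw [hEnd, Nat.add_sub_cancel] at h
    exact h
  have hE'deg : E'.degree ≤ (k : ℕ) := degree_le_of_natDegree_le hE'le
  have hE'form := eq_prod_of_roots k E' hE'deg γ hγmono hγ3 0 hγneg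
  -- the constant is the leading coefficient (k+1)·lE > 0
  have hE'k : E'.coeff k = ((k : ℝ) + 1) * lE := by
    rw [hE', coeff_derivative, show E.coeff (k + 1) = lE by
      rw [← hElc, Polynomial.leadingCoeff, hEnd]]
    ring
  obtain ⟨lq, hlq⟩ : ∃ lq : ℝ, lq = E'.eval 0 / ∏ j ∈ range k, (0 - γ j) := ⟨_, rfl⟩
  rw [← hlq] at hE'form
  have hlqeq : lq = ((k : ℝ) + 1) * lE := by
    have h1 : (C lq * ∏ j ∈ range k, (X - C (γ j))).coeff k = lq := by
      rcases eq_or_ne lq 0 with h0 | h0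
      · rw [h0, C_0, zero_mul, coeff_zero]
      · obtain ⟨hnd, hlc⟩ := prodForm_natDegree lq h0 γ k
        rw [Polynomial.leadingCoeff, hnd] at hlc
        exact hlc
    rw [← hE'form, hE'k] at h1
    exact h1.symm
  have hlqpos : 0 < lq := by rw [hlqeq]; positivity
  have hE'ev : ∀ y, E'.eval y = lq * ∏ i ∈ range k, (y - γ i) := fun y => by rw [hE'form, prodForm_eval]
  ------------------------------------------------------------------ E♭ (IVT)
  obtain ⟨Eb, hEb⟩ : ∃ Eb : ℝ[X], Eb = C ((k : ℝ) + 1) * E - E' * X := ⟨_, rfl⟩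
  have hEbev : ∀ y, Eb.eval y = ((k : ℝ) + 1) * E.eval y - E'.eval y * y := fun y => by
    rw [hEb, eval_sub, eval_mul, eval_C, eval_mul, eval_X]
  -- signs: at γ_j the value is (k+1)E(γ_j), at ρ_{j+1} it is -ρ_{j+1}E'(ρ_{j+1})
  have hs1 : ∀ j, j < k → 0 < (-1 : ℝ) ^ (k - j) * Eb.eval (γ j) := by
    intro j hj
    have hs := sign_prod (k + 1) (k - j) ρ (γ j) (by omega)
      (fun i hi => by linarith [hρle i j (by omega), hγ1 j hj])
      (fun i hi hi' => by linarith [hγ2 j hj, hρle (j + 1) i (by omega)])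
    rw [hEbev, hγ3 j hj, zero_mul, sub_zero, hEev,
      show (-1 : ℝ) ^ (k - j) * ((↑k + 1) * (lE * ∏ i ∈ range (k + 1), (γ j - ρ i)))
        = ((↑k + 1) * lE) * ((-1 : ℝ) ^ (k - j) * ∏ i ∈ range (k + 1), (γ j - ρ i)) by ring]
    exact mul_pos (by positivity) hs
  have hs2 : ∀ j, j < k → 0 < (-1 : ℝ) ^ (k - j - 1) * Eb.eval (ρ (j + 1)) := by
    intro j hj
    have hs := sign_prod k (k - j - 1) γ (ρ (j + 1)) (by omega)
      (fun i hi => by linarith [hγ2 i (by omega), hρle (i + 1) (j + 1) (by omega)])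
      (fun i hi hi' => by linarith [hρle (j + 1) i (by omega), hγ1 i hi'])
    have hρ' : 0 < -ρ (j + 1) := by linarith [hρneg (j + 1)]
    rw [hEbev, hEroot (j + 1) (by omega), mul_zero, zero_sub, hE'ev,
      show (-1 : ℝ) ^ (k - j - 1) * -(lq * (∏ i ∈ range k, (ρ (j + 1) - γ i)) * ρ (j + 1))
        = (lq * -ρ (j + 1)) * ((-1 : ℝ) ^ (k - j - 1) * ∏ i ∈ range k, (ρ (j + 1) - γ i)) by ring]
    exact mul_pos (mul_pos hlqpos hρ') hs
  have hexα : ∀ j, j < k → ∃ x, γ j < x ∧ x < ρ (j + 1) ∧ Eb.eval x = 0 := by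
    intro j hj
    apply exists_root_of_sign_change _ Eb.continuous _ _ (hγ2 j hj)
    have h1 := hs1 j hj
    have h2 := hs2 j hj
    rw [show (-1 : ℝ) ^ (k - j) = (-1) ^ (k - j - 1) * (-1) by
      rw [← pow_succ, show k - j - 1 + 1 = k - j by omega]] at h1
    exact mul_neg_of_signs _ _ _ h1 h2
  choose! α hα using hexα
  have hα1 : ∀ j, j < k → γ j < α j := fun j hj => (hα j hj).1
  have hα2 : ∀ j, j < k → α j < ρ (j + 1) := fun j hj => (hα j hj).2.1
  have hα3 : ∀ j, j < k → Eb.eval (α j) = 0 := fun j hj => (hα j hj).2.2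
  have hαmono : ∀ i j, i < j → j < k → α i < α j := by
    intro i j hij hjk; linarith [hα2 i (by omega), hρle (i + 1) j (by omega), hγ1 j hjk, hα1 j hjk]
  have hαneg : ∀ j, j < k → α j < 0 := fun j hj => lt_trans (hα2 j hj) (hρneg _)
  -- degree of E♭ ≤ k (the X^{k+1} terms cancel)
  have hE'ne : E' ≠ 0 := by
    intro h0
    have := hE'k
    rw [h0, coeff_zero] at this
    have : (0 : ℝ) < 0 := by
      calc (0 : ℝ) = (↑k + 1) * lE := this
        _ > 0 := by positivity
    exact lt_irrefl _ this
  have hE'nd : E'.natDegree = k :=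
    le_antisymm hE'le (le_natDegree_of_ne_zero (by rw [hE'k]; positivity))
  have hEbdeg : Eb.degree ≤ (k : ℕ) := by
    rw [hEb]
    refine degree_sub_le_of_cancel _ _ k ?_ ?_ ?_
    · rw [natDegree_C_mul (by positivity), hEnd]
    · rw [natDegree_mul_X hE'ne, hE'nd]
    · rw [leadingCoeff_mul_X, Polynomial.leadingCoeff, Polynomial.leadingCoeff,
        natDegree_C_mul (by positivity), hEnd, coeff_C_mul, hE'nd, hE'k, ← hElc, Polynomial.leadingCoeff, hEnd]
  have hEbform := eq_prod_of_roots k Eb hEbdeg α hαmono hα3 0 hαneg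
  obtain ⟨lp, hlp⟩ : ∃ lp : ℝ, lp = Eb.eval 0 / ∏ j ∈ range k, (0 - α j) := ⟨_, rfl⟩
  rw [← hlp] at hEbform
  have hlppos : 0 < lp := by
    rw [hlp]
    refine div_pos ?_ (prod_pos fun j hj => by rw [mem_range] at hj; linarith [hαneg j hj])
    rw [hEbev, mul_zero, sub_zero, hE, eval_prod]
    refine mul_pos (by positivity) (prod_pos fun σ _ => ?_)
    rw [eval_add, eval_one, eval_mul, eval_C, eval_X, mul_zero, add_zero]
    exact one_pos
  refine ⟨lp, lq, α, γ, hlppos, hlqpos, hαneg, hα1, fun i hi => ?_, ?_, ?_⟩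
  · linarith [hα2 i (by omega), hγ1 (i + 1) hi]
  · rw [← hE, ← hE', ← hEbform, hEb]
  · rw [← hE, ← hE', hE'form]


/-- **THEOREM R^neut, kernel form.**  Let `0 < b_0 < … < b_k` (so `T = k+1` neutral copies), `q > 0`,
`e_d = [X^d] ∏_{σ≤k}(1 + b_σ X)` the elementary symmetric functions of the idle weights.  Then the kernel
`K(2m, l) = (q + k + l)·e_{m-l}` (`l ≤ m`), `K(2m+1, l) = ((m+1)(q+k) + (1-q) l)·e_{m+1-l}` (`l ≤ m+1`) — the
operator Hurwitz matrix `R(W_T^{(q)})` of the neutral copies up to positive diagonal scalings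
(`neutral_hurwitz_tn`) — is totally nonnegative.  Proof: `K` is obtained from the odd Hurwitz kernel of the
neutral pair `(E♭, E')` (`oddPair_hurwitz_tn`, `neutralPair_roots`) by an up-step, a positive row scaling and a
down-step (the pencil `A_m = ((q+m-1)/T)E♭_m + ((q+m-1+T)/T)E'_m`, `B_m = (q+m)E♭_{m+1} + (m+1)E'_{m+1}`). -/
theorem neutral_hurwitz_kernel_tn (k : ℕ) (b : ℕ → ℝ) (hb0 : 0 < b 0) (hb : StrictMono b) (q : ℝ)
    (hq : 0 < q) (e : ℕ → ℝ) (he : ∀ d, e d = (∏ σ ∈ range (k + 1), (1 + C (b σ) * X)).coeff d)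
    {m : ℕ} (r s : Fin m → ℕ) (hr : StrictMono r) (hs : StrictMono s) :
    0 ≤ (Matrix.of fun i j =>
      if r i % 2 = 0 then (if s j ≤ r i / 2 then (q + k + s j) * e (r i / 2 - s j) else 0)
      else (if s j ≤ r i / 2 + 1 then ((((r i / 2 : ℕ) : ℝ) + 1) * (q + k) + (1 - q) * s j) * e (r i / 2 + 1 - s j)
        else 0)).det := by
  obtain ⟨lp, lq, α, γ, hlp, hlq, hαneg, hJ1, hJ2, hEbform, hE'form⟩ := neutralPair_roots k b hb0 hb
  set E : ℝ[X] := ∏ σ ∈ range (k + 1), (1 + C (b σ) * X) with hE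
  set E' : ℝ[X] := derivative E with hE'
  set Eb : ℝ[X] := C ((k : ℝ) + 1) * E - E' * X with hEb
  -- coefficients of the pair in terms of the elementary symmetric functions
  have hcE' : ∀ d, E'.coeff d = ((d : ℝ) + 1) * e (d + 1) := fun d => by
    rw [hE', coeff_derivative, he]; ring
  have hcEb : ∀ d, Eb.coeff d = ((k : ℝ) + 1 - d) * e d := by
    intro d
    rw [hEb, coeff_sub, coeff_C_mul, ← he]
    rcases d with _ | d
    · rw [coeff_mul_X_zero]; push_cast; ring
    · rw [coeff_mul_X, hcE']; push_cast; ring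
  -- the odd Hurwitz kernel of (E♭, E') is TN
  set M : ℕ → ℕ → ℝ := fun t l =>
    if t % 2 = 0 then (if l ≤ t / 2 then Eb.coeff (t / 2 - l) else 0)
    else (if l ≤ t / 2 then E'.coeff (t / 2 - l) else 0) with hM
  have hMtn : ∀ (m : ℕ) (r s : Fin m → ℕ), StrictMono r → StrictMono s →
      0 ≤ (Matrix.of fun i j => M (r i) (s j)).det := by
    intro m r s hr hs
    have h := oddPair_hurwitz_tn k lp lq α γ hlp hlq hαneg hJ1 hJ2 r s hr hs
    rw [← hEbform, ← hE'form] at h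
    simpa only [hM] using h
  ------------------------------------------------------------------ the pipeline
  have hqm : ∀ m : ℕ, 0 < q + (m : ℝ) := fun m => by positivity
  have hqmk : ∀ m : ℕ, 0 < q + (m : ℝ) + k := fun m => by positivity
  -- up-step on the odd rows
  set f : ℕ → ℝ := fun t => if t % 2 = 0 then 0 else (((t / 2 : ℕ) : ℝ) + 1) / (q + ((t / 2 : ℕ) : ℝ)) with hf
  have hf0 : ∀ t, 0 ≤ f t := fun t => by
    simp only [hf]; split_ifs
    · exact le_rfl
    · exact div_nonneg (by positivity) (hqm _).le
  set M₁ : ℕ → ℕ → ℝ := fun t l => M t l + f t * M (t + 1) l with hM₁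
  have hM₁tn : ∀ (m : ℕ) (r s : Fin m → ℕ), StrictMono r → StrictMono s →
      0 ≤ (Matrix.of fun i j => M₁ (r i) (s j)).det :=
    fun m r s hr hs => stepUp_tn M f hf0 (by simp [hf]) hMtn r s hr hs
  -- row scaling of the even rows t ≥ 2
  set d : ℕ → ℝ := fun t => if t % 2 = 0 ∧ 2 ≤ t then (q + k) / (q + ((t / 2 : ℕ) : ℝ) + k) else 1 with hd
  have hdpos : ∀ t, 0 < d t := fun t => by
    simp only [hd]; split_ifs
    · exact div_pos (by positivity) (hqmk _)
    · exact one_pos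
  set M₂ : ℕ → ℕ → ℝ := fun t l => d t * M₁ t l with hM₂
  have hM₂tn : ∀ (m : ℕ) (r s : Fin m → ℕ), StrictMono r → StrictMono s →
      0 ≤ (Matrix.of fun i j => M₂ (r i) (s j)).det := by
    intro m r s hr hs
    have heq : (Matrix.of fun i j => M₂ (r i) (s j)) =
        Matrix.of fun i j => d (r i) * M₁ (r i) (s j) * (fun _ => (1 : ℝ)) (s j) := by
      ext i j; simp [hM₂]
    rw [heq, TNKernel.det_kernel_scale M₁ d (fun _ => (1 : ℝ)) r s]
    exact mul_nonneg (prod_nonneg fun i _ => (hdpos _).le)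
      (mul_nonneg (prod_nonneg fun _ _ => zero_le_one) (hM₁tn m r s hr hs))
  -- down-step on the even rows t ≥ 2
  set g : ℕ → ℝ := fun t => if t % 2 = 0 ∧ 2 ≤ t then (q + ((t / 2 : ℕ) : ℝ) - 1) / (q + ((t / 2 : ℕ) : ℝ) + k) else 0
    with hg
  have hg0 : ∀ t, 0 ≤ g t := fun t => by
    simp only [hg]; split_ifs with h
    · refine div_nonneg ?_ (hqmk _).le
      have : (1 : ℝ) ≤ ((t / 2 : ℕ) : ℝ) := by exact_mod_cast (show 1 ≤ t / 2 by omega)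
      linarith
    · exact le_rfl
  set M₃ : ℕ → ℕ → ℝ := fun t l => M₂ t l + g t * M₂ (t - 1) l with hM₃
  have hM₃tn : ∀ (m : ℕ) (r s : Fin m → ℕ), StrictMono r → StrictMono s →
      0 ≤ (Matrix.of fun i j => M₃ (r i) (s j)).det := by
    intro m r s hr hs
    have heq : (Matrix.of fun i j => M₃ (r i) (s j)) =
        Matrix.of fun i j => M₂ (r i) (s j) + g (r i) * M₂ (r i - 1) (s j) + (fun _ => (0 : ℝ)) (r i) * M₂ (r i + 1) (s j) := by
      ext i j; simp [hM₃]
    rw [heq]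
    exact tridiagStep_tn M₂ g (fun _ => 0) hg0 (fun _ => le_rfl) (by simp [hg]) rfl (fun _ => mul_zero _)
      hM₂tn r s hr hs
  ------------------------------------------------------------------ closed forms of the pipeline rows
  have hrow_odd : ∀ n l, M₃ (2 * n + 1) l = M (2 * n + 1) l + (((n : ℕ) : ℝ) + 1) / (q + n) * M (2 * n + 2) l := by
    intro n l
    have h1 : ¬ ((2 * n + 1) % 2 = 0 ∧ 2 ≤ 2 * n + 1) := by omega
    have h2 : ¬ (2 * n + 1) % 2 = 0 := by omega
    simp only [hM₃, hM₂, hM₁, hg, hd, hf, if_neg h1, if_neg h2, show (2 * n + 1) / 2 = n by omega,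
      show 2 * n + 1 + 1 = 2 * n + 2 by ring]
    ring
  have hrow_zero : ∀ l, M₃ 0 l = M 0 l := by
    intro l
    simp only [hM₃, hM₂, hM₁, hg, hd, hf]
    norm_num
  have hrow_even : ∀ n l, M₃ (2 * n + 2) l = M (2 * n + 2) l + (q + n) / (q + n + 1 + k) * M (2 * n + 1) l := by
    intro n l
    have h1 : (2 * n + 2) % 2 = 0 ∧ 2 ≤ 2 * n + 2 := by omega
    have h2 : ¬ ((2 * n + 2 - 1) % 2 = 0 ∧ 2 ≤ 2 * n + 2 - 1) := by omega
    have h3 : ¬ (2 * n + 2 - 1) % 2 = 0 := by omega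
    have h4 : (2 * n + 2) % 2 = 0 := by omega
    simp only [hM₃, hM₂, hM₁, hg, hd, hf, if_pos h1, if_neg h2, if_neg h3, if_pos h4,
      show (2 * n + 2) / 2 = n + 1 by omega, show (2 * n + 2 - 1) / 2 = n by omega,
      show 2 * n + 2 - 1 + 1 = 2 * n + 2 by omega]
    have hne1 : q + ((n + 1 : ℕ) : ℝ) + k ≠ 0 := ne_of_gt (hqmk _)
    have hne2 : q + (n : ℝ) ≠ 0 := ne_of_gt (hqm _)
    have hne3 : q + (n : ℝ) + 1 + k ≠ 0 := by
      have := hqmk (n + 1); push_cast at this; exact ne_of_gt (by linarith)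
    push_cast
    field_simp
    ring

  ------------------------------------------------------------------ K = λ · M₃ entrywise, then rescale
  have hMev : ∀ n l, M (2 * n + 2) l = if l ≤ n + 1 then Eb.coeff (n + 1 - l) else 0 := by
    intro n l; simp only [hM, show (2 * n + 2) % 2 = 0 by omega, if_true, show (2 * n + 2) / 2 = n + 1 by omega]
  have hMod : ∀ n l, M (2 * n + 1) l = if l ≤ n then E'.coeff (n - l) else 0 := by
    intro n l; simp only [hM, show ¬ (2 * n + 1) % 2 = 0 by omega, if_false, show (2 * n + 1) / 2 = n by omega]
  have hM0 : ∀ l, M 0 l = if l ≤ 0 then Eb.coeff (0 - l) else 0 := by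
    intro l; simp only [hM, Nat.zero_mod, if_true, Nat.zero_div]
  set lam : ℕ → ℝ := fun t =>
    if t % 2 = 0 then (q + ((t / 2 : ℕ) : ℝ) + k) / ((k : ℝ) + 1) else q + ((t / 2 : ℕ) : ℝ) with hlam
  have hlampos : ∀ t, 0 < lam t := fun t => by
    simp only [hlam]; split_ifs
    · exact div_pos (hqmk _) (by positivity)
    · exact hqm _
  have hk1 : ((k : ℝ) + 1) ≠ 0 := by positivity
  have hK : ∀ t l, (if t % 2 = 0 then (if l ≤ t / 2 then (q + k + l) * e (t / 2 - l) else 0)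
      else (if l ≤ t / 2 + 1 then ((((t / 2 : ℕ) : ℝ) + 1) * (q + k) + (1 - q) * l) * e (t / 2 + 1 - l)
        else 0)) = lam t * M₃ t l * (fun _ => (1 : ℝ)) l := by
    intro t l
    rw [mul_one]
    rcases Nat.even_or_odd' t with ⟨n, rfl | rfl⟩
    · have hpar : (2 * n) % 2 = 0 := by omega
      have hdiv : (2 * n) / 2 = n := by omega
      rw [if_pos hpar]
      simp only [hlam, if_pos hpar, hdiv]
      rcases n with _ | n
      · rw [show 2 * 0 = 0 by rfl, hrow_zero, hM0]
        by_cases hl : l ≤ 0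
        · have hl0 : l = 0 := by omega
          subst hl0
          rw [if_pos le_rfl, if_pos le_rfl, Nat.sub_zero, hcEb]; push_cast; field_simp; ring
        · rw [if_neg hl, if_neg hl]; ring
      · rw [show 2 * (n + 1) = 2 * n + 2 by ring, hrow_even, hMev, hMod]
        by_cases hl : l ≤ n + 1
        · rw [if_pos hl, if_pos hl]
          by_cases hl' : l ≤ n
          · obtain ⟨a, rfl⟩ := Nat.exists_eq_add_of_le hl'
            rw [if_pos hl', show l + a + 1 - l = a + 1 by omega, show l + a - l = a by omega, hcEb, hcE']
            have hne : q + ((l + a : ℕ) : ℝ) + 1 + k ≠ 0 := by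
              have := hqmk (l + a + 1); push_cast at this ⊢; exact ne_of_gt (by linarith)
            push_cast
            field_simp
            ring
          · have hl1 : l = n + 1 := by omega
            subst hl1
            rw [if_neg hl', Nat.sub_self, hcEb]
            have hne : q + (n : ℝ) + 1 + k ≠ 0 := by
              have := hqmk (n + 1); push_cast at this; exact ne_of_gt (by linarith)
            push_cast
            field_simp
            ring
        · rw [if_neg hl, if_neg hl, if_neg (by omega)]; ring
    · have hpar : ¬ (2 * n + 1) % 2 = 0 := by omega
      have hdiv : (2 * n + 1) / 2 = n := by omega
      rw [if_neg hpar]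
      simp only [hlam, if_neg hpar, hdiv]
      rw [hrow_odd, hMod, hMev]
      by_cases hl : l ≤ n + 1
      · rw [if_pos hl, if_pos hl]
        by_cases hl' : l ≤ n
        · obtain ⟨a, rfl⟩ := Nat.exists_eq_add_of_le hl'
          rw [if_pos hl', show l + a + 1 - l = a + 1 by omega, show l + a - l = a by omega, hcEb, hcE']
          have hne : q + ((l + a : ℕ) : ℝ) ≠ 0 := ne_of_gt (hqm _)
          push_cast at hne ⊢
          field_simp
          ring
        · have hl1 : l = n + 1 := by omega
          subst hl1
          rw [if_neg hl', Nat.sub_self, hcEb]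
          have hne : q + (n : ℝ) ≠ 0 := ne_of_gt (hqm _)
          push_cast
          field_simp
          ring
      · rw [if_neg hl, if_neg hl, if_neg (by omega)]; ring
  have heq : (Matrix.of fun i j =>
      if r i % 2 = 0 then (if s j ≤ r i / 2 then (q + k + s j) * e (r i / 2 - s j) else 0)
      else (if s j ≤ r i / 2 + 1 then ((((r i / 2 : ℕ) : ℝ) + 1) * (q + k) + (1 - q) * s j) * e (r i / 2 + 1 - s j)
        else 0)) = Matrix.of fun i j => lam (r i) * M₃ (r i) (s j) * (fun _ => (1 : ℝ)) (s j) := by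
    ext i j; rw [Matrix.of_apply, Matrix.of_apply]; exact hK (r i) (s j)
  rw [heq, TNKernel.det_kernel_scale M₃ lam (fun _ => (1 : ℝ)) r s]
  exact mul_nonneg (prod_nonneg fun i _ => (hlampos _).le)
    (mul_nonneg (prod_nonneg fun _ _ => zero_le_one) (hM₃tn m r s hr hs))


end DiffHurwitz

end Summit.CriticalPhenomena.PercolationContinuityZ3.Theorems
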